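import Summits.HodgeConjecture.CorCM.HodgeLieAlgebraReductive
import Literature.Algebra.Lie.KillingSubalgebraSmallCodimension
import Mathlib.Algebra.Lie.SkewAdjoint
import HarnessLib

/-!
# The Hodge Lie algebra is never a codimension-one subalgebra of the Lefschetz Lie algebra (no factor of type IV); a
# `ℚ`-simple Hodge Lie algebra of small codimension IS the Lefschetz Lie algebra

COR-CM (cell `pub-hodgecm2`, seat `b27` gen 45, count-neutral Mumford–Tate-rank ladder; theorems only, no definition, no named
fact; UNCONDITIONAL — nothing here uses or asserts HC_CM).  For a complex abelian variety `X` WITHOUT FACTOR OF TYPE IV and a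
polarization `ψ` of `H¹X`, write `𝔥 = Lie Hg(H¹X)` and `Lef(ψ) = C_{End H¹X}(End_Hdg H¹X) ∩ 𝔰𝔭(H¹X, ψ)` (the Lefschetz Lie algebra:
`ψ`-skew endomorphisms commuting with all Hodge endomorphisms; Moonen–Zarhin §1 «`Hg(X) ⊂ Sp_D(V, φ)`», Milne 1999 §2).  Always
`𝔥 ⊆ Lef(ψ)`; `𝔥` is semisimple with non-degenerate Killing form (`CorCM/HodgeLieAlgebraReductive`, `𝔷 = 0`); and the centraliser
of `𝔥` in `Lef(ψ)` is `Z(End_Hdg) ∩ 𝔰𝔭(ψ) = 0` (the commutant of `𝔥` is `End_Hdg`; central `ψ`-skew Hodge endomorphisms vanish when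
there is no factor of type IV, `forall_central_skew_eq_zero_hodge_one_of_hasNoTypeIVFactor`).  The Lie-theoretic rigidity of
`Literature/Algebra/Lie/KillingSubalgebraSmallCodimension` (every derivation of a Killing Lie algebra is inner) then gives:

* **`hodgeLie_hodge_one_eq_lefschetz_of_forall_lie_mem`** — if `Lef(ψ)` normalises `𝔥` (`[x, h] ∈ 𝔥` for `x ∈ Lef(ψ)`, `h ∈ 𝔥`),
  then `𝔥 = Lef(ψ)`.
* **`finrank_lefschetz_ne_finrank_hodgeLie_add_one`** — **`dim Lef(ψ) ≠ dim 𝔥 + 1`**: the Hodge Lie algebra is the whole Lefschetz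
  Lie algebra or has codimension `≥ 2` in it (`𝔥` is perfect, so codimension one would be normalising).
* **`hodgeLie_hodge_one_eq_lefschetz_of_isSimple_of_sq_lt`** — if `𝔥` is `ℚ`-SIMPLE and `(dim Lef(ψ) − dim 𝔥)² < dim 𝔥`, then
  `𝔥 = Lef(ψ)` (the representation of `𝔥` on `Lef/𝔥` is trivial).
The quaternion-fourfold case (`dim Lef = 10`, `dim 𝔥 ∈ {8, 9}` excluded, Moonen–Zarhin Thm. (0.1) (4)) is
`CorCM/MumfordTateRankTypeTwoFourfoldLefschetz`; the present file records the general statements.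

## References
* [MoonenZarhin1999LowDim] B. Moonen, Yu. Zarhin, Math. Ann. 315 (1999), §1 (`Hg(X) ⊂ Sp_D(V, φ)`; no type IV: `Hg` semisimple).
* [Milne1999LefschetzClasses] J. S. Milne, Duke Math. J. 96 (1999), §2 (the Lefschetz group as a centraliser), Summary.
* [Humphreys1972] J. E. Humphreys, GTM 9 (1972), §5.2, §5.3 (derivations of a semisimple Lie algebra are inner).
-/

noncomputable section

open scoped TensorProduct
open CategoryTheory CategoryTheory.Limits Module

namespace Summit.HodgeConjecture.CorCM

open Literature.AlgebraicGeometry.Motives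
open Literature.AlgebraicGeometry.Motives.AbelianVariety
open Literature.AlgebraicGeometry.Motives.HodgeStructure
open Literature.AlgebraicGeometry.HodgeTheory
open Literature.Algebra.Lie

variable [HodgeTensorFacts.{0, 0}] {X : AbelianVariety ℂ} {n : ℕ}

/-! ## §1 A normalised Hodge Lie algebra is the Lefschetz Lie algebra -/

/-- **If the Lefschetz Lie algebra `Lef(ψ) = C(End_Hdg H¹X) ∩ 𝔰𝔭(H¹X, ψ)` normalises the Hodge Lie algebra `𝔥 = Lie Hg(H¹X)`, then
`𝔥 = Lef(ψ)`** (no factor of type IV): `𝔥` is a Killing Lie algebra, `𝔥 ⊆ Lef(ψ)`, the centraliser of `𝔥` in `Lef(ψ)` consists of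
CENTRAL `ψ`-skew Hodge endomorphisms, which vanish, and a normalised Killing subalgebra with trivial centraliser is everything (all
its derivations are inner). [cite: MoonenZarhin1999LowDim, §1] [cite: Humphreys1972, §5.3 Theorem] -/
theorem hodgeLie_hodge_one_eq_lefschetz_of_forall_lie_mem (hX : IsSmoothProjective n X.X) (hA4 : HasNoTypeIVFactor X)
    [Module.Finite ℚ (bettiCohomology X.X 1)] (ψ : (BettiUniverse.hodge exists_isReal_hodgeModel_holds hX 1).Polarization)
    (hnorm : ∀ x ∈ Subalgebra.toSubmodule (Subalgebra.centralizer ℚ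
        ((BettiUniverse.hodge exists_isReal_hodgeModel_holds hX 1).endAlg : Set (Module.End ℚ (bettiCohomology X.X 1)))) ⊓
          ψ.form.skewAdjointSubmodule,
      ∀ h ∈ (BettiUniverse.hodge exists_isReal_hodgeModel_holds hX 1).hodgeLie,
        x * h - h * x ∈ (BettiUniverse.hodge exists_isReal_hodgeModel_holds hX 1).hodgeLie) :
    (BettiUniverse.hodge exists_isReal_hodgeModel_holds hX 1).hodgeLie =
      Subalgebra.toSubmodule (Subalgebra.centralizer ℚ
          ((BettiUniverse.hodge exists_isReal_hodgeModel_holds hX 1).endAlg : Set (Module.End ℚ (bettiCohomology X.X 1)))) ⊓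
        ψ.form.skewAdjointSubmodule := by
  classical
  have hn : X.dim = n := schemeDim_eq_holds hX
  subst hn
  letI : LieRing (Module.End ℚ (bettiCohomology X.X 1)) := LieRing.ofAssociativeRing
  have hspan := hodgeLie_hodge_one_derived_eq_of_hasNoTypeIVFactor hX hA4
  change Submodule.span ℚ {B' | ∃ X' ∈ (BettiUniverse.hodge exists_isReal_hodgeModel_holds hX 1).hodgeLie,
      ∃ Y ∈ (BettiUniverse.hodge exists_isReal_hodgeModel_holds hX 1).hodgeLie, X' * Y - Y * X' = B'} =
    (BettiUniverse.hodge exists_isReal_hodgeModel_holds hX 1).hodgeLie at hspan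
  -- the two Lie subalgebras
  obtain ⟨L, hL⟩ : ∃ L : LieSubalgebra ℚ (Module.End ℚ (bettiCohomology X.X 1)), L.toSubmodule =
      Subalgebra.toSubmodule (Subalgebra.centralizer ℚ
        ((BettiUniverse.hodge exists_isReal_hodgeModel_holds hX 1).endAlg : Set (Module.End ℚ (bettiCohomology X.X 1)))) ⊓ ψ.form.skewAdjointSubmodule :=
    ⟨{ (Subalgebra.toSubmodule (Subalgebra.centralizer ℚ
          ((BettiUniverse.hodge exists_isReal_hodgeModel_holds hX 1).endAlg : Set (Module.End ℚ (bettiCohomology X.X 1)))) ⊓ ψ.form.skewAdjointSubmodule) with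
        lie_mem' := fun {Y Z} hY hZ => by
          obtain ⟨hYc, hYs⟩ := Submodule.mem_inf.1 hY
          obtain ⟨hZc, hZs⟩ := Submodule.mem_inf.1 hZ
          refine Submodule.mem_inf.2 ⟨?_, ψ.form.isSkewAdjoint_bracket hYs hZs⟩
          rw [Subalgebra.mem_toSubmodule] at hYc hZc ⊢
          rw [LieRing.of_associative_ring_bracket]
          exact Subalgebra.sub_mem _ (Subalgebra.mul_mem _ hYc hZc) (Subalgebra.mul_mem _ hZc hYc) }, rfl⟩
  obtain ⟨𝔏, h𝔏⟩ : ∃ 𝔏 : LieSubalgebra ℚ (Module.End ℚ (bettiCohomology X.X 1)),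
      𝔏.toSubmodule = (BettiUniverse.hodge exists_isReal_hodgeModel_holds hX 1).hodgeLie :=
    ⟨{ (BettiUniverse.hodge exists_isReal_hodgeModel_holds hX 1).hodgeLie with
        lie_mem' := fun {Y Z} hY hZ => by
          rw [LieRing.of_associative_ring_bracket]
          exact HodgeStructure.commutator_mem_hodgeLie _ hY hZ }, rfl⟩
  have hmem𝔏 : ∀ Y, Y ∈ 𝔏 ↔ Y ∈ (BettiUniverse.hodge exists_isReal_hodgeModel_holds hX 1).hodgeLie := fun Y => by
    rw [← LieSubalgebra.mem_toSubmodule, h𝔏]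
  have hmemL : ∀ Y, Y ∈ L ↔
      (∀ g ∈ (BettiUniverse.hodge exists_isReal_hodgeModel_holds hX 1).endAlg, g * Y = Y * g) ∧ Y ∈ ψ.form.skewAdjointSubmodule := fun Y => by
    rw [← LieSubalgebra.mem_toSubmodule, hL, Submodule.mem_inf, Subalgebra.mem_toSubmodule, Subalgebra.mem_centralizer_iff]
    rfl
  have hle : 𝔏 ≤ L := by
    intro Y hY
    rw [hmem𝔏] at hY
    rw [hmemL]
    refine ⟨fun g hg => (commute_of_mem_hodgeLie _ hY ⟨g, hg⟩).symm, ?_⟩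
    rw [LinearMap.mem_skewAdjointSubmodule]
    intro v w
    rw [Pi.neg_apply, map_neg, ← add_eq_zero_iff_eq_neg]
    exact form_apply_add_eq_zero_of_mem_hodgeLie ψ hY v w
  haveI : Module.Finite ℚ 𝔏 := Module.Finite.of_injective 𝔏.toSubmodule.subtype Subtype.val_injective
  haveI : LieAlgebra.IsKilling ℚ 𝔏 :=
    isKilling_of_eq_hodgeLie_derived _ (by simp) (BettiUniverse.hodge_isEffective _ hX 1) ψ 𝔏 (by rw [h𝔏, hspan])
  -- `C_L(𝔥) = 0`: central `ψ`-skew Hodge endomorphisms vanish (no type IV)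
  have hE := forall_central_skew_eq_zero_hodge_one_of_hasNoTypeIVFactor hA4 exists_isReal_hodgeModel_holds
    hodgePQ_independent_of_hodgeModel_holds ψ
  have hcent : ∀ x ∈ L, (∀ h ∈ 𝔏, ⁅x, h⁆ = 0) → x = 0 := by
    intro x hx hxc
    obtain ⟨hxc', hxs⟩ := (hmemL x).1 hx
    have hxA : x ∈ (BettiUniverse.hodge exists_isReal_hodgeModel_holds hX 1).endAlg := mem_endAlg_of_forall_commute _ fun Y hY => by
      have h0 := hxc Y ((hmem𝔏 Y).2 hY)
      rw [LieRing.of_associative_ring_bracket, sub_eq_zero] at h0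
      exact h0
    rw [LinearMap.mem_skewAdjointSubmodule] at hxs
    refine hE x hxA (fun b hb => (hxc' b hb).symm) fun v w => ?_
    rw [hxs v w, Pi.neg_apply, map_neg, neg_add_cancel]
  have hideal : ∀ x ∈ L, ∀ h ∈ 𝔏, ⁅x, h⁆ ∈ 𝔏 := by
    intro x hx h hh
    rw [hmem𝔏] at hh ⊢
    rw [LieRing.of_associative_ring_bracket]
    exact hnorm x (by rw [← hL]; exact hx) h hh
  have hEq := KillingCodimension.eq_of_isKilling_of_forall_lie_mem_of_centralizer 𝔏 L hle hideal hcent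
  rw [← hL, ← h𝔏, hEq]

/-! ## §2 No codimension one -/

/-- **`dim Lef(ψ) ≠ dim Lie Hg(H¹X) + 1`** for a complex abelian variety without factor of type IV and any polarization `ψ`: the
Hodge Lie algebra is PERFECT (`𝔥 = [𝔥, 𝔥]`, `𝔷 = 0`), so in codimension one it would be normalised by `Lef(ψ)`
(`lie_mem_of_finrank_le_succ_of_perfect`), hence equal to it (§1).  Thus `Lie Hg` is the Lefschetz Lie algebra or has codimension
at least `2` in it. [cite: MoonenZarhin1999LowDim, §1] [cite: Humphreys1972, §5.2] -/
theorem finrank_lefschetz_ne_finrank_hodgeLie_add_one (hX : IsSmoothProjective n X.X) (hA4 : HasNoTypeIVFactor X)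
    [Module.Finite ℚ (bettiCohomology X.X 1)] (ψ : (BettiUniverse.hodge exists_isReal_hodgeModel_holds hX 1).Polarization) :
    Module.finrank ℚ ↥(Subalgebra.toSubmodule (Subalgebra.centralizer ℚ
          ((BettiUniverse.hodge exists_isReal_hodgeModel_holds hX 1).endAlg : Set (Module.End ℚ (bettiCohomology X.X 1)))) ⊓
        ψ.form.skewAdjointSubmodule) ≠
      Module.finrank ℚ (BettiUniverse.hodge exists_isReal_hodgeModel_holds hX 1).hodgeLie + 1 := by
  classical
  have hn : X.dim = n := schemeDim_eq_holds hX
  subst hn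
  letI : LieRing (Module.End ℚ (bettiCohomology X.X 1)) := LieRing.ofAssociativeRing
  intro hdim
  have hspan := hodgeLie_hodge_one_derived_eq_of_hasNoTypeIVFactor hX hA4
  change Submodule.span ℚ {B' | ∃ X' ∈ (BettiUniverse.hodge exists_isReal_hodgeModel_holds hX 1).hodgeLie,
      ∃ Y ∈ (BettiUniverse.hodge exists_isReal_hodgeModel_holds hX 1).hodgeLie, X' * Y - Y * X' = B'} =
    (BettiUniverse.hodge exists_isReal_hodgeModel_holds hX 1).hodgeLie at hspan
  obtain ⟨L, hL⟩ : ∃ L : LieSubalgebra ℚ (Module.End ℚ (bettiCohomology X.X 1)), L.toSubmodule =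
      Subalgebra.toSubmodule (Subalgebra.centralizer ℚ
        ((BettiUniverse.hodge exists_isReal_hodgeModel_holds hX 1).endAlg : Set (Module.End ℚ (bettiCohomology X.X 1)))) ⊓ ψ.form.skewAdjointSubmodule :=
    ⟨{ (Subalgebra.toSubmodule (Subalgebra.centralizer ℚ
          ((BettiUniverse.hodge exists_isReal_hodgeModel_holds hX 1).endAlg : Set (Module.End ℚ (bettiCohomology X.X 1)))) ⊓ ψ.form.skewAdjointSubmodule) with
        lie_mem' := fun {Y Z} hY hZ => by
          obtain ⟨hYc, hYs⟩ := Submodule.mem_inf.1 hY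
          obtain ⟨hZc, hZs⟩ := Submodule.mem_inf.1 hZ
          refine Submodule.mem_inf.2 ⟨?_, ψ.form.isSkewAdjoint_bracket hYs hZs⟩
          rw [Subalgebra.mem_toSubmodule] at hYc hZc ⊢
          rw [LieRing.of_associative_ring_bracket]
          exact Subalgebra.sub_mem _ (Subalgebra.mul_mem _ hYc hZc) (Subalgebra.mul_mem _ hZc hYc) }, rfl⟩
  obtain ⟨𝔏, h𝔏⟩ : ∃ 𝔏 : LieSubalgebra ℚ (Module.End ℚ (bettiCohomology X.X 1)),
      𝔏.toSubmodule = (BettiUniverse.hodge exists_isReal_hodgeModel_holds hX 1).hodgeLie :=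
    ⟨{ (BettiUniverse.hodge exists_isReal_hodgeModel_holds hX 1).hodgeLie with
        lie_mem' := fun {Y Z} hY hZ => by
          rw [LieRing.of_associative_ring_bracket]
          exact HodgeStructure.commutator_mem_hodgeLie _ hY hZ }, rfl⟩
  have hmem𝔏 : ∀ Y, Y ∈ 𝔏 ↔ Y ∈ (BettiUniverse.hodge exists_isReal_hodgeModel_holds hX 1).hodgeLie := fun Y => by
    rw [← LieSubalgebra.mem_toSubmodule, h𝔏]
  have hmemL : ∀ Y, Y ∈ L ↔
      (∀ g ∈ (BettiUniverse.hodge exists_isReal_hodgeModel_holds hX 1).endAlg, g * Y = Y * g) ∧ Y ∈ ψ.form.skewAdjointSubmodule := fun Y => by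
    rw [← LieSubalgebra.mem_toSubmodule, hL, Submodule.mem_inf, Subalgebra.mem_toSubmodule, Subalgebra.mem_centralizer_iff]
    rfl
  have hle : 𝔏 ≤ L := by
    intro Y hY
    rw [hmem𝔏] at hY
    rw [hmemL]
    refine ⟨fun g hg => (commute_of_mem_hodgeLie _ hY ⟨g, hg⟩).symm, ?_⟩
    rw [LinearMap.mem_skewAdjointSubmodule]
    intro v w
    rw [Pi.neg_apply, map_neg, ← add_eq_zero_iff_eq_neg]
    exact form_apply_add_eq_zero_of_mem_hodgeLie ψ hY v w
  haveI : Module.Finite ℚ L := Module.Finite.of_injective L.toSubmodule.subtype Subtype.val_injective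
  have hdim𝔏 : Module.finrank ℚ 𝔏 = Module.finrank ℚ (BettiUniverse.hodge exists_isReal_hodgeModel_holds hX 1).hodgeLie := by
    rw [← h𝔏]; rfl
  have hdimL : Module.finrank ℚ L = Module.finrank ℚ (BettiUniverse.hodge exists_isReal_hodgeModel_holds hX 1).hodgeLie + 1 := by
    rw [← hdim, ← hL]; rfl
  -- codimension one over the perfect `𝔥`: `Lef(ψ)` normalises `𝔥`, hence equals it
  have hideal := KillingCodimension.lie_mem_of_finrank_le_succ_of_perfect 𝔏 L hle (by omega) (by
    rw [h𝔏, ← hspan]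
    refine Submodule.span_mono ?_
    rintro B' ⟨X', hX', Y, hY, rfl⟩
    exact ⟨X', (hmem𝔏 X').2 hX', Y, (hmem𝔏 Y).2 hY, by rw [LieRing.of_associative_ring_bracket]⟩)
  have heq := hodgeLie_hodge_one_eq_lefschetz_of_forall_lie_mem hX hA4 ψ fun x hx h hh => by
    have h1 := hideal x (by rw [← LieSubalgebra.mem_toSubmodule, hL]; exact hx) h ((hmem𝔏 h).2 hh)
    rw [hmem𝔏, LieRing.of_associative_ring_bracket] at h1
    exact h1
  have hfin : Module.finrank ℚ (BettiUniverse.hodge exists_isReal_hodgeModel_holds hX 1).hodgeLie =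
      Module.finrank ℚ ↥(Subalgebra.toSubmodule (Subalgebra.centralizer ℚ
        ((BettiUniverse.hodge exists_isReal_hodgeModel_holds hX 1).endAlg : Set (Module.End ℚ (bettiCohomology X.X 1)))) ⊓
          ψ.form.skewAdjointSubmodule) := by
    rw [← heq]
  omega

/-! ## §3 `ℚ`-simple Hodge Lie algebra of small codimension -/

/-- **A `ℚ`-SIMPLE Hodge Lie algebra with `(dim Lef(ψ) − dim Lie Hg)² < dim Lie Hg` is the Lefschetz Lie algebra** (no factor of
type IV): the representation of `𝔥` on `Lef(ψ)/𝔥` is trivial (`lie_mem_of_isSimple_of_sq_lt_finrank`), so `Lef(ψ)` normalises `𝔥`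
and §1 applies. [cite: MoonenZarhin1999LowDim, §1] [cite: Humphreys1972, §5.2] -/
theorem hodgeLie_hodge_one_eq_lefschetz_of_isSimple_of_sq_lt (hX : IsSmoothProjective n X.X) (hA4 : HasNoTypeIVFactor X)
    [Module.Finite ℚ (bettiCohomology X.X 1)] (ψ : (BettiUniverse.hodge exists_isReal_hodgeModel_holds hX 1).Polarization)
    (hsimple : letI : LieRing (Module.End ℚ (bettiCohomology X.X 1)) := LieRing.ofAssociativeRing
      ∀ 𝔏 : LieSubalgebra ℚ (Module.End ℚ (bettiCohomology X.X 1)),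
        𝔏.toSubmodule = (BettiUniverse.hodge exists_isReal_hodgeModel_holds hX 1).hodgeLie → LieAlgebra.IsSimple ℚ 𝔏)
    (hlt : (Module.finrank ℚ ↥(Subalgebra.toSubmodule (Subalgebra.centralizer ℚ
          ((BettiUniverse.hodge exists_isReal_hodgeModel_holds hX 1).endAlg : Set (Module.End ℚ (bettiCohomology X.X 1)))) ⊓
        ψ.form.skewAdjointSubmodule) - Module.finrank ℚ (BettiUniverse.hodge exists_isReal_hodgeModel_holds hX 1).hodgeLie) ^ 2 <
      Module.finrank ℚ (BettiUniverse.hodge exists_isReal_hodgeModel_holds hX 1).hodgeLie) :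
    (BettiUniverse.hodge exists_isReal_hodgeModel_holds hX 1).hodgeLie =
      Subalgebra.toSubmodule (Subalgebra.centralizer ℚ
          ((BettiUniverse.hodge exists_isReal_hodgeModel_holds hX 1).endAlg : Set (Module.End ℚ (bettiCohomology X.X 1)))) ⊓
        ψ.form.skewAdjointSubmodule := by
  classical
  letI : LieRing (Module.End ℚ (bettiCohomology X.X 1)) := LieRing.ofAssociativeRing
  obtain ⟨L, hL⟩ : ∃ L : LieSubalgebra ℚ (Module.End ℚ (bettiCohomology X.X 1)), L.toSubmodule =
      Subalgebra.toSubmodule (Subalgebra.centralizer ℚ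
        ((BettiUniverse.hodge exists_isReal_hodgeModel_holds hX 1).endAlg : Set (Module.End ℚ (bettiCohomology X.X 1)))) ⊓ ψ.form.skewAdjointSubmodule :=
    ⟨{ (Subalgebra.toSubmodule (Subalgebra.centralizer ℚ
          ((BettiUniverse.hodge exists_isReal_hodgeModel_holds hX 1).endAlg : Set (Module.End ℚ (bettiCohomology X.X 1)))) ⊓ ψ.form.skewAdjointSubmodule) with
        lie_mem' := fun {Y Z} hY hZ => by
          obtain ⟨hYc, hYs⟩ := Submodule.mem_inf.1 hY
          obtain ⟨hZc, hZs⟩ := Submodule.mem_inf.1 hZ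
          refine Submodule.mem_inf.2 ⟨?_, ψ.form.isSkewAdjoint_bracket hYs hZs⟩
          rw [Subalgebra.mem_toSubmodule] at hYc hZc ⊢
          rw [LieRing.of_associative_ring_bracket]
          exact Subalgebra.sub_mem _ (Subalgebra.mul_mem _ hYc hZc) (Subalgebra.mul_mem _ hZc hYc) }, rfl⟩
  obtain ⟨𝔏, h𝔏⟩ : ∃ 𝔏 : LieSubalgebra ℚ (Module.End ℚ (bettiCohomology X.X 1)),
      𝔏.toSubmodule = (BettiUniverse.hodge exists_isReal_hodgeModel_holds hX 1).hodgeLie :=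
    ⟨{ (BettiUniverse.hodge exists_isReal_hodgeModel_holds hX 1).hodgeLie with
        lie_mem' := fun {Y Z} hY hZ => by
          rw [LieRing.of_associative_ring_bracket]
          exact HodgeStructure.commutator_mem_hodgeLie _ hY hZ }, rfl⟩
  haveI := hsimple 𝔏 h𝔏
  have hmem𝔏 : ∀ Y, Y ∈ 𝔏 ↔ Y ∈ (BettiUniverse.hodge exists_isReal_hodgeModel_holds hX 1).hodgeLie := fun Y => by
    rw [← LieSubalgebra.mem_toSubmodule, h𝔏]
  have hmemL : ∀ Y, Y ∈ L ↔
      (∀ g ∈ (BettiUniverse.hodge exists_isReal_hodgeModel_holds hX 1).endAlg, g * Y = Y * g) ∧ Y ∈ ψ.form.skewAdjointSubmodule := fun Y => by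
    rw [← LieSubalgebra.mem_toSubmodule, hL, Submodule.mem_inf, Subalgebra.mem_toSubmodule, Subalgebra.mem_centralizer_iff]
    rfl
  have hle : 𝔏 ≤ L := by
    intro Y hY
    rw [hmem𝔏] at hY
    rw [hmemL]
    refine ⟨fun g hg => (commute_of_mem_hodgeLie _ hY ⟨g, hg⟩).symm, ?_⟩
    rw [LinearMap.mem_skewAdjointSubmodule]
    intro v w
    rw [Pi.neg_apply, map_neg, ← add_eq_zero_iff_eq_neg]
    exact form_apply_add_eq_zero_of_mem_hodgeLie ψ hY v w
  haveI : Module.Finite ℚ L := Module.Finite.of_injective L.toSubmodule.subtype Subtype.val_injective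
  have hdim𝔏 : Module.finrank ℚ 𝔏 = Module.finrank ℚ (BettiUniverse.hodge exists_isReal_hodgeModel_holds hX 1).hodgeLie := by
    rw [← h𝔏]; rfl
  have hdimL : Module.finrank ℚ L = Module.finrank ℚ ↥(Subalgebra.toSubmodule (Subalgebra.centralizer ℚ
      ((BettiUniverse.hodge exists_isReal_hodgeModel_holds hX 1).endAlg : Set (Module.End ℚ (bettiCohomology X.X 1)))) ⊓
        ψ.form.skewAdjointSubmodule) := by
    rw [← hL]; rfl
  have hideal := KillingCodimension.lie_mem_of_isSimple_of_sq_lt_finrank 𝔏 L hle (by rw [hdim𝔏, hdimL]; exact hlt)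
  exact hodgeLie_hodge_one_eq_lefschetz_of_forall_lie_mem hX hA4 ψ fun x hx h hh => by
    have h1 := hideal x (by rw [← LieSubalgebra.mem_toSubmodule, hL]; exact hx) h ((hmem𝔏 h).2 hh)
    rw [hmem𝔏, LieRing.of_associative_ring_bracket] at h1
    exact h1

end Summit.HodgeConjecture.CorCM

end
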